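import Summits.KontsevichZagierPeriods.Zeta5Search.LaiSweepShard

/-!
# `κ₃` sweep certificate — shard file 004 of 127 (shards 28–34 of 889)

HONEST FRAMING. Systematic search; no irrationality claim unless certified. This file only checks,
by `decide +kernel`, shards 28–34 of the order-cell sweep of the `κ₃` point `(74, 2180, 444; δ74)`
(engine `LaiSweepEngine`, soundness `LaiSweepJump/Free/Eval/Shard/Kappa3`; a shard is `⟨regime, n,
p, q, p', q', Lo, Up⟩`: `n` cells from `p/q` to `p'/q'` with integer rate sums in `[Lo, Up]`, `K =
128`, `D = 2^40`). It draws NO conclusion: only the capstone `LaiKappa3SweepCert`, which needs all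
127 shard files, does. Kernel cost of this file ≈ 560 cells × 0.3 s.
-/

namespace Summit.KontsevichZagierPeriods.Zeta5Search.Sweep

set_option maxHeartbeats 100000000 in
/-- Shard 28: 80 cells of regime A from `10/1133` to `20/2201`.
[cite: Lai2024BallRivoal, §4 Lemma 4.3] -/
theorem shard028 :
    Shard.check 128 (2^40)
      ⟨false, 80, 10, 1133, 20, 2201, 232050035139544, 232168599558414⟩ = true := by
  decide +kernel

set_option maxHeartbeats 100000000 in
/-- Shard 29: 80 cells of regime A from `20/2201` to `6/643`.
[cite: Lai2024BallRivoal, §4 Lemma 4.3] -/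
theorem shard029 :
    Shard.check 128 (2^40)
      ⟨false, 80, 20, 2201, 6, 643, 219987454128577, 220093955555082⟩ = true := by
  decide +kernel

set_option maxHeartbeats 100000000 in
/-- Shard 30: 80 cells of regime A from `6/643` to `25/2608`.
[cite: Lai2024BallRivoal, §4 Lemma 4.3] -/
theorem shard030 :
    Shard.check 128 (2^40)
      ⟨false, 80, 6, 643, 25, 2608, 230245319702563, 230365593986907⟩ = true := by
  decide +kernel

set_option maxHeartbeats 100000000 in
/-- Shard 31: 80 cells of regime A from `25/2608` to `25/2544`.
[cite: Lai2024BallRivoal, §4 Lemma 4.3] -/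
theorem shard031 :
    Shard.check 128 (2^40)
      ⟨false, 80, 25, 2608, 25, 2544, 200829621669729, 200926917999821⟩ = true := by
  decide +kernel

set_option maxHeartbeats 100000000 in
/-- Shard 32: 80 cells of regime A from `25/2544` to `11/1097`.
[cite: Lai2024BallRivoal, §4 Lemma 4.3] -/
theorem shard032 :
    Shard.check 128 (2^40)
      ⟨false, 80, 25, 2544, 11, 1097, 153561721078732, 153621566380960⟩ = true := by
  decide +kernel

set_option maxHeartbeats 100000000 in
/-- Shard 33: 80 cells of regime A from `11/1097` to `23/2238`.
[cite: Lai2024BallRivoal, §4 Lemma 4.3] -/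
theorem shard033 :
    Shard.check 128 (2^40)
      ⟨false, 80, 11, 1097, 23, 2238, 181709282401280, 181793552516081⟩ = true := by
  decide +kernel

set_option maxHeartbeats 100000000 in
/-- Shard 34: 80 cells of regime A from `23/2238` to `23/2192`.
[cite: Lai2024BallRivoal, §4 Lemma 4.3] -/
theorem shard034 :
    Shard.check 128 (2^40)
      ⟨false, 80, 23, 2238, 23, 2192, 150183466423636, 150245419995758⟩ = true := by
  decide +kernel

/-- The checked shards of this file, in order. [folklore] -/
def shards004 : List (CheckedShard 128 (2^40)) :=
  [⟨_, shard028⟩, ⟨_, shard029⟩, ⟨_, shard030⟩, ⟨_, shard031⟩, ⟨_, shard032⟩,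
    ⟨_, shard033⟩, ⟨_, shard034⟩]

end Summit.KontsevichZagierPeriods.Zeta5Search.Sweep
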